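import Summits.HodgeConjecture.CorCM.Census.TwentyFourCyclicSpecies

/-!
# Degree-24 atlas, type `ℤ/24` (sequel): the `4096` eigen-labels, the Galois action, the total type `Φ`, Pohlmann's Hodge forms, the
# Hodge lattice `H ⊂ ℤ^{4096}` and the divisor pairs `P` (kernel census; faces, minimality and the lattice theorem in the further sequels)

COR-CM (cell `pub-hodgecm2`), count-neutral kernel census by the literature seat lit-andre-3 (gen 16; claim TWENTYFOUR-ATLAS), sequel of
`Census/TwentyFourCyclicSpecies.lean` (same conventions, dictionary and citations; statements VERBATIM those of
`Census/IcosicCyclicSpecies.lean` §labels and §Pohlmann, with `hodgeVec_conj` PROVED from `inPhi_conj` instead of decided over the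
`24 · 4096` sign entries).  Labels `Pt` (`4096 = 2·8 + 170·24`): `s i u` (`u ∈ ℤ/8 = Hom(K₀, ℚ̄)`, the fourfold `S_i`), `q b g`
(`g ∈ ℤ/24 = Hom(F, ℚ̄)`, the twelvefold `B_b`); `act` = translation (through `eps : ℤ/24 → ℤ/8` on the `S`-labels); `inPhi` = the total
type `Φ`; `labels_census`; `hodgeForm`/`hodgeVec` [cite: Pohlmann1968, Thm 1], `hodgeLattice` (`Submodule ℤ`), `mem_hodgeLattice`, `ind`,
`pairVec`, `pairs`, `pairs_le`, `transl`, `hodgeVec_dotProduct_transl`.  No named fact, no `sorry`.  HC_CM is not proved anywhere in this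
cell; nothing here is a headline.

## References
* [Pohlmann1968] H. Pohlmann, Algebraic cycles on abelian varieties of complex multiplication type, Ann. of Math. 88 (1968), Thm 1.
* [Milne1999] J. S. Milne, Lefschetz motives and the Tate conjecture, Compositio Math. 117 (1999), Prop. 2.1, p. 54.
-/

namespace Summit.HodgeConjecture.CorCM.Census.TwentyFourCyclicSpecies

open Finset

/-! ## Labels, the Galois action, the total type -/

/-- Labels of the CM eigenvectors: `s i u` (`u ∈ ℤ/8 ≅ G/⟨8⟩ = Hom(K₀, ℚ̄)`, the fourfold `S_i`) and `q b g` (`g ∈ ℤ/24 = Hom(F, ℚ̄)`, the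
twelvefold `B_b`); `4096 = 2·8 + 170·24` labels. [folklore] -/
abbrev Pt := (Fin 2 × ZMod 8) ⊕ (Fin 170 × ZMod 24)

/-- `s i u`: the eigen-label `u ∈ ℤ/8` of the fourfold `S_i`. [folklore] -/
abbrev s (i : Fin 2) (u : ZMod 8) : Pt := Sum.inl (i, u)

/-- `q b g`: the eigen-label `g ∈ ℤ/24` of the twelvefold `B_b`. [folklore] -/
abbrev q (b : Fin 170) (g : ZMod 24) : Pt := Sum.inr (b, g)

/-- `|Pt| = 4096`. [folklore] -/
theorem card_Pt : Fintype.card Pt = 4096 := by simp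

/-- The quotient map `ℤ/24 → ℤ/8 = G/⟨8⟩` (reduction mod `8`; kernel `{0, 8, 16}`): restriction of the embedding `g` to `K₀`. [folklore] -/
def eps (g : ZMod 24) : ZMod 8 := (g.val : ZMod 8)

/-- `G = ℤ/24` acts on the labels by translation (Galois conjugation of eigenvectors / of coefficients). [folklore] -/
def act (g : ZMod 24) : Pt → Pt
  | Sum.inl (i, u) => Sum.inl (i, eps g + u)
  | Sum.inr (b, h) => Sum.inr (b, g + h)

/-- The residues mod `8` of the two fourfold types, as `8`-bit masks: `{0,1,2,3}` and `{0,2,3,5}`. [folklore] -/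
def fourMask : Fin 2 → ℕ := ![15, 45]

/-- Boolean membership in the total CM type `Φ` (labels of Hodge type `(1,0)`): `s i u ∈ Φ ↔ u ∈ fourMask i`, `q b g ∈ Φ ↔ g ∈ blockType (2 + b)`. [folklore] -/
def inPhi : Pt → Bool
  | Sum.inl (i, u) => (fourMask i).testBit u.val
  | Sum.inr (b, g) => (blockMask ⟨b.val + 2, by omega⟩).testBit g.val

set_option maxRecDepth 100000 in set_option maxHeartbeats 4000000 in
/-- **Labels census**: `eps` is a homomorphism onto `ℤ/8` with kernel `⟨8⟩`; `Φ` is the total type induced by the block types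
(`s i (eps g) ∈ Φ ↔ g ∈ blockType i`; `q b g ∈ Φ ↔ g ∈ blockType (2 + b)` by `rfl`, `inPhi_q_iff`); conjugation `c = 12` complements `Φ` and
moves every label; `|Φ| = 2048`. [folklore] -/
theorem labels_census : (∀ g h : ZMod 24, eps (g + h) = eps g + eps h) ∧ (univ.filter fun g : ZMod 24 => eps g = 0) = {0, 8, 16} ∧
    (∀ i : Fin 2, ∀ g : ZMod 24, inPhi (s i (eps g)) = (blockMask ⟨i.val, by omega⟩).testBit g.val) ∧
    (∀ x : Pt, inPhi (act 12 x) = !inPhi x) ∧ (∀ x : Pt, act 12 x ≠ x) ∧ (univ.filter fun x : Pt => inPhi x = true).card = 2048 := by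
  refine ⟨by decide +kernel, by decide +kernel, by decide +kernel, by decide +kernel, by decide +kernel, by decide +kernel⟩

/-- `s i (eps g) ∈ Φ ↔ g ∈ blockType i`. [folklore] -/
theorem inPhi_s_iff (i : Fin 2) (g : ZMod 24) : inPhi (s i (eps g)) = true ↔ g ∈ blockType ⟨i.val, by omega⟩ := by
  rw [labels_census.2.2.1, blockType, mem_maskType]

/-- `q b g ∈ Φ ↔ g ∈ blockType (2 + b)`. [folklore] -/
theorem inPhi_q_iff (b : Fin 170) (g : ZMod 24) : inPhi (q b g) = true ↔ g ∈ blockType ⟨b.val + 2, by omega⟩ := by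
  rw [blockType, mem_maskType]; rfl

/-- Conjugation complements `Φ`. [folklore] -/
theorem inPhi_conj (x : Pt) : inPhi (act 12 x) = !inPhi x := labels_census.2.2.2.1 x

/-- Conjugation moves every label. [folklore] -/
theorem conj_ne (x : Pt) : act 12 x ≠ x := labels_census.2.2.2.2.1 x

/-- `act` is an action of `ℤ/24`. [folklore] -/
theorem act_add (g h : ZMod 24) (x : Pt) : act (g + h) x = act g (act h x) := by
  rcases x with ⟨i, u⟩ | ⟨b, k⟩
  · show Sum.inl (i, eps (g + h) + u) = Sum.inl (i, eps g + (eps h + u))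
    rw [labels_census.1, add_assoc]
  · show Sum.inr (b, g + h + k) = Sum.inr (b, g + (h + k))
    rw [add_assoc]

/-- `act 0 = id`. [folklore] -/
theorem act_zero (x : Pt) : act 0 x = x := by
  rcases x with ⟨i, u⟩ | ⟨b, k⟩
  · show Sum.inl (i, eps 0 + u) = Sum.inl (i, u)
    rw [show eps 0 = 0 from by decide, zero_add]
  · show Sum.inr (b, 0 + k) = Sum.inr (b, k)
    rw [zero_add]

/-- Translations commute. [folklore] -/
theorem act_comm (g h : ZMod 24) (x : Pt) : act g (act h x) = act h (act g x) := by
  rw [← act_add, add_comm, act_add]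

/-- Translation by `g` as a permutation of the labels. [folklore] -/
def actEquiv (g : ZMod 24) : Pt ≃ Pt where
  toFun := act g
  invFun := act (-g)
  left_inv x := by
    show act (-g) (act g x) = x
    rw [← act_add, neg_add_cancel, act_zero]
  right_inv x := by
    show act g (act (-g) x) = x
    rw [← act_add, add_neg_cancel, act_zero]

/-! ## Pohlmann's Hodge forms and the Hodge lattice -/

/-- Pohlmann's Hodge functional of `g ∈ ℤ/24` on integer exponent vectors: `Σ_x (2[g·x ∈ Φ] − 1) m_x`. [cite: Pohlmann1968, Thm 1] -/
def hodgeForm (g : ZMod 24) (m : Pt → ℤ) : ℤ := ∑ x : Pt, (if inPhi (act g x) then m x else -m x)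

/-- The coefficient vector `(2[g·x ∈ Φ] − 1)_x ∈ {±1}^{4096}` of `hodgeForm g`. [cite: Pohlmann1968, Thm 1] -/
def hodgeVec (g : ZMod 24) (x : Pt) : ℤ := if inPhi (act g x) then 1 else -1

/-- Pohlmann's form is the dot product with its coefficient vector. [folklore] -/
theorem hodgeForm_eq (g : ZMod 24) (m : Pt → ℤ) : hodgeForm g m = hodgeVec g ⬝ᵥ m := by
  unfold hodgeForm dotProduct hodgeVec
  refine Finset.sum_congr rfl fun x _ => ?_
  by_cases hx : inPhi (act g x) = true <;> simp [hx]

/-- **The Hodge lattice** `H ⊂ ℤ^{4096}` of the whole `F`-slice (rank `4084` by the oracle). [cite: Pohlmann1968, Thm 1] -/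
def hodgeLattice : Submodule ℤ (Pt → ℤ) where
  carrier := {m | ∀ g : ZMod 24, hodgeVec g ⬝ᵥ m = 0}
  zero_mem' := by intro g; simp
  add_mem' := by
    intro m m' hm hm' g
    rw [dotProduct_add, hm g, hm' g, add_zero]
  smul_mem' := by
    intro c m hm g
    rw [dotProduct_smul, hm g, smul_zero]

/-- Membership in the Hodge lattice = vanishing of all Pohlmann forms. [folklore] -/
theorem mem_hodgeLattice (m : Pt → ℤ) : m ∈ hodgeLattice ↔ ∀ g : ZMod 24, hodgeForm g m = 0 := by
  simp only [hodgeForm_eq]; rfl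

/-- Indicator vector of a set of labels (a square-free monomial). [folklore] -/
def ind (S : Finset Pt) (y : Pt) : ℤ := if y ∈ S then 1 else 0

/-- Dot product with an indicator = sum over the set. [folklore] -/
theorem dotProduct_ind (v : Pt → ℤ) (S : Finset Pt) : v ⬝ᵥ ind S = ∑ x ∈ S, v x := by
  unfold dotProduct ind
  simp only [mul_ite, mul_one, mul_zero]
  rw [Finset.sum_ite_mem, Finset.univ_inter]

/-- The conjugate pair through a label (a divisor-class monomial `e_x ∧ e_{cx}`). [folklore] -/
def pairVec (x : Pt) : Pt → ℤ := ind {x, act 12 x}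

/-- The divisor sublattice `P = ℤ⟨2048 conjugate pairs⟩`. [folklore] -/
def pairs : Submodule ℤ (Pt → ℤ) := Submodule.span ℤ (Set.range pairVec)

/-- Galois translate of an exponent vector: `(g·v)(y) = v(y − g)`. [folklore] -/
def transl (g : ZMod 24) (v : Pt → ℤ) (y : Pt) : ℤ := v (act (-g) y)

/-- Conjugation reverses every Pohlmann sign. [folklore] -/
theorem hodgeVec_conj (g : ZMod 24) (x : Pt) : hodgeVec g (act 12 x) = -hodgeVec g x := by
  unfold hodgeVec
  rw [act_comm, inPhi_conj (act g x)]
  cases inPhi (act g x) <;> simp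

/-- Every conjugate pair is a Hodge vector. [folklore] -/
theorem pairVec_hodge (x : Pt) (g : ZMod 24) : hodgeVec g ⬝ᵥ pairVec x = 0 := by
  rw [pairVec, dotProduct_ind, Finset.sum_pair (conj_ne x).symm, hodgeVec_conj g x]
  ring

/-- `P ≤ H`. [folklore] -/
theorem pairs_le : pairs ≤ hodgeLattice :=
  Submodule.span_le.mpr (by rintro _ ⟨x, rfl⟩ g; exact pairVec_hodge x g)

/-- Translation equivariance of the Pohlmann signs: `⟨σ_g, h·v⟩ = ⟨σ_{g+h}, v⟩`. [folklore] -/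
theorem hodgeVec_dotProduct_transl (g h : ZMod 24) (v : Pt → ℤ) : hodgeVec g ⬝ᵥ transl h v = hodgeVec (g + h) ⬝ᵥ v := by
  unfold dotProduct transl
  rw [← Equiv.sum_comp (actEquiv h) (fun y => hodgeVec g y * v (act (-h) y))]
  refine Finset.sum_congr rfl fun z _ => ?_
  show hodgeVec g (act h z) * v (act (-h) (act h z)) = hodgeVec (g + h) z * v z
  rw [← act_add, neg_add_cancel, act_zero]
  unfold hodgeVec
  rw [← act_add]

end Summit.HodgeConjecture.CorCM.Census.TwentyFourCyclicSpecies
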